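/-
Copyright (c) 2026 the pub-hodgecm-mathlib formalisation cell (harness21).  Prover seat hodgecm-mathlib-K2E1-p08 (g5), Track B ∕ K2-LIT, h413 =
`stmt-HodgeConjecture-24833`, campaign «EIS-RANK-ONE» [D5] `K2E1KFiniteArchSmoothU2`, Fréchet road, file (D5-a3): the archimedean smoothness binder `hφarch` DISCHARGED for the
spherical flat section of `U(1,1)` over a CM field (dealer K2E1-plan (g4) 2026-09-04T06:23:41Z, my cut 06:24:54Z).
-/
import Summits.HodgeConjecture.HodgeConjecture.Theorems.K2E1HeightBigCellLineFormulaU2     -- ★ (D5-a2): `H(ι(w₀)·n(θ(ι⁻¹ s, b))·k) = ((∏_w (1 + (wδ)² s_w²))·h_f(b))⁻¹`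
import Summits.HodgeConjecture.HodgeConjecture.Theorems.K2E1OnePlusSqPowerSymbol          -- ★ (D5-a1): `(1 + c s²)^{−z}` is a symbol, `‖F⁽ʲ⁾‖ ≤ C·(1 + c s²)^{−Re z}`
import Summits.HodgeConjecture.HodgeConjecture.Theorems.K2E1TensorSymbolProduct            -- ★ (D5-a3 core): pull-backs and finite products of symbols
import Summits.HodgeConjecture.HodgeConjecture.Theorems.K2E1BorelEisensteinUDefs           -- ★ `flatSectionU φ z = φ·H^z`
import Summits.HodgeConjecture.HodgeConjecture.Theorems.K2E1EisensteinMinusConstantTermBoundedLevelCMTwo   -- ★ p857911 (K2E1-p09 g5): the consumers of `hφarch` (finite-level letter)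
import HarnessLib

/-!
# K2·E1 — `K2E1HeightLineArchSmoothU2` ([D5] file (D5-a3)): THE ARCHIMEDEAN SMOOTHNESS BINDER `hφarch` HOLDS FOR THE SPHERICAL FLAT SECTION OF `U(1,1)` —
# `s ↦ f_z(ι(w₀)·n(θ(ι⁻¹ s, b))·k)` is `C^m` on `L⁺ ⊗ ℝ` with `‖Dʲ‖ ≤ C_φ·H^{Re z}` (`j ≤ m`), uniformly in `k ∈ K_U`, `b ∈ 𝔸_{L⁺}^∞`

Track B ∕ K2-LIT, crux h413 = `stmt-HodgeConjecture-24833`, route of record `HCCMUnconditional`; cell `hodgecm-mathlib`, squad K2, ENGINE E1, campaign EIS-RANK-ONE, deal [D5]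
`K2E1KFiniteArchSmoothU2` (spherical case).  Prover seat `hodgecm-mathlib-K2E1-p08` (g5).  THEOREMS ONLY (no `def`, no `instance`, no notation, no named-fact hypothesis, no `sorry`);
lane `--kind proof --supports stmt-HodgeConjecture-24833 --as helper` (count-neutral, closes no socket).

WHAT.  ★ `K2E1EisensteinMinusConstantTermBoundedLevelCMTwo.exists_bound_sub_borelConstantTerm_level_cm_two_of_archSmooth` (and its `Λ^T` twin, and the `K_U`-letter editions of ★
`K2E1EisensteinMinusConstantTermBoundedArchCMTwo`) take ONE archimedean input, the binder
`hφarch : ∀ k ∈ K_U, ∀ b, ContDiff ℝ m ((a ↦ f_z(ι(w₀)·n(θ(a, b))·k)) ∘ ι⁻¹) ∧ ∀ j ≤ m, ∀ s, ‖Dʲ((a ↦ f_z(ι(w₀)·n(θ(a, b))·k)) ∘ ι⁻¹)(s)‖ ≤ C_φ·H(ι(w₀)·n(θ(ι⁻¹ s, b))·k)^{Re z}`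
(`f_z = flatSectionU φ z = φ·H^z`, `ι = ringEquiv_mixedSpace L⁺`, `θ = traceZeroLine`, `n = middleRootUnipotent`).  THIS FILE PROVES IT for the spherical vector `φ ≡ φ₀`:
**`exists_archSmooth_flatSectionU_const_cm_two`** — `∀ z φ₀ m, ∃ C_φ ≥ 0, hφarch[φ := fun _ => φ₀]` VERBATIM.
HOW (Fréchet road).  §1 complex-power bookkeeping (`((∏ aᵢ)·h)⁻¹)^z = (h⁻¹)^z · ∏ aᵢ^{−z}` for positive reals, norms).  §2 by ★ (D5-a2) the line function IS, in closed form,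
`s ↦ φ₀ · (h_f(b)⁻¹)^z · ∏_{w∣∞ of L} (1 + (wδ)²·s_{w|L⁺}²)^{−z}` (`flatSectionU_const_line_apply_cm_two`) — a constant times a TENSOR PRODUCT over the places of the one-variable
symbols of ★ (D5-a1) pulled back along the coordinate forms `ℓ_w = proj_{w|L⁺} ∘ fst` (`‖ℓ_w‖ ≤ 1`).  §3 ★ (D5-a3 core) `exists_norm_iteratedFDeriv_finset_prod_le` gives `C'` with
`‖Dʲ ∏_w‖ ≤ C'·∏_w (1 + (wδ)² s_w²)^{−Re z}`, and `‖φ₀‖·h_f^{−Re z}·∏_w (…)^{−Re z} = ‖φ₀‖·H^{Re z}` by ★ (D5-a2) again; `C_φ = ‖φ₀‖·C'` does not depend on `k`, `b`.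
§4 PLUGS IT IN: **`exists_bound_sub_borelConstantTerm_level_cm_two_const`** ∕ **`exists_norm_truncation_flatSectionU_le_level_cm_two_const`** — ★ p857911's two `…_of_archSmooth`
theorems for the spherical flat section `f_z = φ₀·H^z` with `hφc`, `hφM`, `hφB`, `hφU`, `hU₀o`, `hU₀K` (`U₀ = GL₂(𝒪̂_L)`, ★ `isOpen_glFiniteIntegralLevel`), `hCφ`, `hφarch` ALL DISCHARGED:
the only analytic inputs left are the Godement range `1 < Re z`, `m > [L⁺:ℚ]`, and the modularity `hf` of `f_z` under `B(𝔸)` (the character data).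
[MoeglinWaldspurger1995, I.2.10–I.2.12 (smooth `K`-finite sections have symbol-type growth), II.1.5; Hörmander ALPDO I §7.1; Garrett2018, §2.2.]

HONEST LABEL: HC_CM is proved only modulo the 7 printed citations (2 remaining named inputs: hLiu418 = `stmt-HodgeConjecture-24832`, h413 = `stmt-HodgeConjecture-24833`) until
rung 0 closes; count-neutral helper, closes no socket.  The `K`-FINITE (non-spherical) case (D5-b) is not in this file.

## References
* [MoeglinWaldspurger1995] C. Mœglin, J.-L. Waldspurger, *Spectral Decomposition and Eisenstein Series* (1995), I.2.10–I.2.12, II.1.5.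
* [HormanderALPDO1] L. Hörmander, *The Analysis of Linear Partial Differential Operators I* (1983), §7.1.
* [Garrett2018] P. Garrett, *Modern Analysis of Automorphic Forms by Example* (2018), §2.2.
-/

set_option autoImplicit false
-- the mandated namespace repeats the single-problem summit's segment (`HodgeConjecture.HodgeConjecture`)
set_option linter.dupNamespace false

noncomputable section

open NumberField NumberField.InfinitePlace NumberField.mixedEmbedding IsDedekindDomain
open Literature.NumberTheory.Automorphic Literature.NumberTheory.Automorphic.UnitaryGroup AdelicGroupData
open Summit.HodgeConjecture.HodgeConjecture.Cruxes.H413.K2E1BorelEisensteinU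
open Summit.HodgeConjecture.HodgeConjecture.Cruxes.H413.K2E1HeightBigCellLineFormulaU2
open Summit.HodgeConjecture.HodgeConjecture.Cruxes.H413.K2E1OnePlusSqPowerSymbol
open Summit.HodgeConjecture.HodgeConjecture.Cruxes.H413.K2E1TensorSymbolProduct
-- `Classical` is needed to see the Mathlib normed-space instances on `mixedSpace` (note H5 of `AdelicGLnGlue`)
open scoped NNReal ContDiff Classical

namespace Summit.HodgeConjecture.HodgeConjecture.Cruxes.H413.K2E1HeightLineArchSmoothU2

/-! ## §1 Complex powers of positive real products -/

section Cpow

/-- `((∏ᵢ fᵢ : ℝ) : ℂ)^z = ∏ᵢ ((fᵢ : ℝ) : ℂ)^z` for `fᵢ ≥ 0` (Mathlib `Complex.mul_cpow_ofReal_nonneg`, induction). [folklore] -/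
theorem ofReal_prod_cpow_of_nonneg {ι : Type*} (s : Finset ι) {f : ι → ℝ} (hf : ∀ i ∈ s, 0 ≤ f i) (z : ℂ) :
    (((∏ i ∈ s, f i : ℝ)) : ℂ) ^ z = ∏ i ∈ s, (((f i : ℝ)) : ℂ) ^ z := by
  induction s using Finset.induction_on with
  | empty => simp
  | insert a s ha ih =>
    rw [Finset.prod_insert ha, Finset.prod_insert ha, Complex.ofReal_mul,
      Complex.mul_cpow_ofReal_nonneg (hf a (Finset.mem_insert_self a s)) (Finset.prod_nonneg fun i hi => hf i (Finset.mem_insert_of_mem hi)),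
      ih fun i hi => hf i (Finset.mem_insert_of_mem hi)]

/-- `((x⁻¹ : ℝ) : ℂ)^z = ((x : ℝ) : ℂ)^{−z}` for `x ≥ 0` (principal branch; `arg x = 0`). [folklore] -/
theorem ofReal_inv_cpow_of_nonneg {x : ℝ} (hx : 0 ≤ x) (z : ℂ) : (((x⁻¹ : ℝ)) : ℂ) ^ z = (((x : ℝ)) : ℂ) ^ (-z) := by
  rw [Complex.ofReal_inv, Complex.inv_cpow _ _ (by rw [Complex.arg_ofReal_of_nonneg hx]; exact Real.pi_ne_zero.symm), Complex.cpow_neg]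

/-- **`(((∏ᵢ aᵢ)·h)⁻¹)^z = (h⁻¹)^z · ∏ᵢ aᵢ^{−z}`** for reals `aᵢ ≥ 0`, `h ≥ 0` (complex exponent, principal branch). [folklore] -/
theorem ofReal_inv_prod_mul_cpow {ι : Type*} (s : Finset ι) {a : ι → ℝ} (ha : ∀ i ∈ s, 0 ≤ a i) {h : ℝ} (hh : 0 ≤ h) (z : ℂ) :
    (((((∏ i ∈ s, a i) * h)⁻¹ : ℝ)) : ℂ) ^ z = (((h⁻¹ : ℝ)) : ℂ) ^ z * ∏ i ∈ s, (((a i : ℝ)) : ℂ) ^ (-z) := by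
  rw [mul_inv, mul_comm, Complex.ofReal_mul, Complex.mul_cpow_ofReal_nonneg (inv_nonneg.2 hh) (inv_nonneg.2 (Finset.prod_nonneg ha)),
    ofReal_inv_cpow_of_nonneg (Finset.prod_nonneg ha), ofReal_prod_cpow_of_nonneg s ha]

/-- **Norms**: `‖(h⁻¹)^z‖ · ∏ᵢ aᵢ^{−Re z} = (((∏ᵢ aᵢ)·h)⁻¹)^{Re z}` for `aᵢ ≥ 0`, `h > 0`. [folklore] -/
theorem norm_ofReal_inv_cpow_mul_prod_rpow_neg {ι : Type*} (s : Finset ι) {a : ι → ℝ} (ha : ∀ i ∈ s, 0 ≤ a i) {h : ℝ} (hh : 0 < h) (z : ℂ) :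
    ‖(((h⁻¹ : ℝ)) : ℂ) ^ z‖ * ∏ i ∈ s, a i ^ (-z.re) = (((∏ i ∈ s, a i) * h)⁻¹) ^ z.re := by
  rw [Complex.norm_cpow_eq_rpow_re_of_pos (inv_pos.2 hh), Real.finsetProd_rpow s a ha, Real.rpow_neg (Finset.prod_nonneg ha), ← Real.inv_rpow (Finset.prod_nonneg ha),
    ← Real.mul_rpow (inv_nonneg.2 hh.le) (inv_nonneg.2 (Finset.prod_nonneg ha)), mul_inv, mul_comm (h⁻¹)]

end Cpow

/-! ## §2 The spherical flat section along the big-cell line, in closed form -/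

section Line

variable (L : Type) [Field L] [NumberField L] [IsCMField L]
  (hij : (((0 : Fin 2) : ℕ)) + 1 = ((1 : Fin 2) : ℕ)) (hN : 2 = 2 * ((0 : Fin 2) : ℕ) + 2)

/-- **THE SPHERICAL FLAT SECTION ALONG THE LINE IS A TENSOR PRODUCT OF ONE-VARIABLE SYMBOLS**: for `k ∈ K_U`, `b ∈ 𝔸_{L⁺}^∞`, `s ∈ L⁺ ⊗ ℝ`,
`f_z(ι(w₀)·n(θ(ι⁻¹ s, b))·k) = φ₀ · (h_f(b)⁻¹)^z · ∏_{w∣∞ of L} (1 + (wδ)²·s_{w|L⁺}²)^{−z}` (`φ ≡ φ₀`; ★ (D5-a2) `coe_borelHeight_weylLongU_line_mul_eq_cm_two`, §1).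
[cite: MoeglinWaldspurger1995, II.1.5, I.2.2] [cite: Garrett2018, §2.2] -/
theorem flatSectionU_const_line_apply_cm_two {δ : L} (hcδ : IsCMField.complexConj L δ = -δ) (hδ : δ ≠ 0) (z φ₀ : ℂ)
    {k : (quasiSplit (↥(maximalRealSubfield L)) L (IsCMField.complexConj L) 2).Adelic}
    (hk : k ∈ ((standardMaximalCompactGL 2 L).comap (adelicVal ↥(maximalRealSubfield L) L (IsCMField.complexConj L) 2 ((StdForm.antidiagonal 2).over L)) : Subgroup (quasiSplit (↥(maximalRealSubfield L)) L (IsCMField.complexConj L) 2).Adelic))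
    (b : FiniteAdeleRing (𝓞 ↥(maximalRealSubfield L)) ↥(maximalRealSubfield L)) (s : mixedSpace ↥(maximalRealSubfield L)) :
    ((fun a : InfiniteAdeleRing ↥(maximalRealSubfield L) => flatSectionU (fun _ : (quasiSplit (↥(maximalRealSubfield L)) L (IsCMField.complexConj L) 2).Adelic => φ₀) z (((quasiSplit (↥(maximalRealSubfield L)) L (IsCMField.complexConj L) 2).toAdelic (weylLongU ((IsCMField.complexConj L : L ≃ₐ[↥(maximalRealSubfield L)] L) : L →+* L) (rfl : ((StdForm.antidiagonal 2).over L) = ((StdForm.antidiagonal 2).over L)))) *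
          ((middleRootUnipotent hij hN (Multiplicative.ofAdd (traceZeroLine ↥(maximalRealSubfield L) L (IsCMField.complexConj L) hcδ hδ ((a, b) : AdeleRing (𝓞 ↥(maximalRealSubfield L)) ↥(maximalRealSubfield L)))) : ↥(adelicUnipotent ↥(maximalRealSubfield L) L (IsCMField.complexConj L) 2)) : (quasiSplit (↥(maximalRealSubfield L)) L (IsCMField.complexConj L) 2).Adelic) * k)) ∘ (InfiniteAdeleRing.ringEquiv_mixedSpace ↥(maximalRealSubfield L)).symm) s =
      φ₀ * (((((∏ᶠ v : HeightOneSpectrum (𝓞 L), max 1 ‖((traceZeroLine ↥(maximalRealSubfield L) L (IsCMField.complexConj L) hcδ hδ ((0, b) : AdeleRing (𝓞 ↥(maximalRealSubfield L)) ↥(maximalRealSubfield L)) : traceZeroAdele ↥(maximalRealSubfield L) L (IsCMField.complexConj L)) : AdeleRing (𝓞 L) L).2 v‖₊ : ℝ≥0) : ℝ)⁻¹ : ℝ) : ℂ) ^ z *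
        ∏ w : InfinitePlace L, ((((1 + (w δ) ^ 2 * (s.1 ⟨w.comap (algebraMap ↥(maximalRealSubfield L) L), K2E1HeightBigCellLineFormulaU2.isReal_comap_maximalRealSubfield L w⟩) ^ 2 : ℝ)) : ℂ) ^ (-z))) := by
  rw [Function.comp_apply, flatSectionU_apply, coe_borelHeight_weylLongU_line_mul_eq_cm_two L hij hN hcδ hδ hk b s,
    ofReal_inv_prod_mul_cpow Finset.univ (fun w _ => (onePlusSq_pos (sq_nonneg (w δ)) _).le) (zero_le_one.trans (one_le_coe_finprod_line_cm_two L hcδ hδ b)) z]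

end Line

/-! ## §3 The binder `hφarch` for the spherical flat section -/

section ArchSmooth

variable (L : Type) [Field L] [NumberField L] [IsCMField L]
  (hij : (((0 : Fin 2) : ℕ)) + 1 = ((1 : Fin 2) : ℕ)) (hN : 2 = 2 * ((0 : Fin 2) : ℕ) + 2)

omit [IsCMField L] in
/-- The coordinate forms `ℓ_v = proj_v ∘ fst` of `mixedSpace K` have norm `≤ 1`. [folklore] -/
theorem norm_proj_comp_fst_le_one (v : {v : InfinitePlace L // v.IsReal}) :
    ‖(ContinuousLinearMap.proj (R := ℝ) (φ := fun _ : {v : InfinitePlace L // v.IsReal} => ℝ) v).comp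
        (ContinuousLinearMap.fst ℝ ({v : InfinitePlace L // v.IsReal} → ℝ) ({v : InfinitePlace L // v.IsComplex} → ℂ))‖ ≤ 1 := by
  refine ContinuousLinearMap.opNorm_le_bound _ zero_le_one fun s => ?_
  rw [one_mul]
  exact (norm_le_pi_norm s.1 v).trans (norm_fst_le s)

/-- **[D5] `K2E1KFiniteArchSmoothU2`, SPHERICAL CASE — THE ARCHIMEDEAN SMOOTHNESS BINDER `hφarch` HOLDS FOR `φ ≡ φ₀`.**  For a CM field `L`, `δ ∈ L⁻ ∖ 0`, ANY `z ∈ ℂ`, `φ₀ ∈ ℂ`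
and `m ∈ ℕ` there is `C_φ ≥ 0` such that for every `k ∈ K_U = π⁻¹(K_{GL₂(𝔸_L)})` and every `b ∈ 𝔸_{L⁺}^∞` the function `(a ↦ f_z(ι(w₀)·n(θ(a, b))·k)) ∘ ι⁻¹` on `mixedSpace L⁺` is
`C^m` and `‖Dʲ((a ↦ f_z(ι(w₀)·n(θ(a, b))·k)) ∘ ι⁻¹)(s)‖ ≤ C_φ · H(ι(w₀)·n(θ(ι⁻¹ s, b))·k)^{Re z}` for all `j ≤ m`, `s` — LITERALLY the hypothesis `hφarch` of ★
`exists_bound_sub_borelConstantTerm_level_cm_two_of_archSmooth` ∕ ★ `exists_norm_truncation_flatSectionU_le_level_cm_two_of_archSmooth` (and of the `K_U`-letter editions ★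
`…ArchCMTwo`) at `φ := fun _ => φ₀`.  Proof: §2 closed form; ★ (D5-a1) per-place symbols `(1 + (wδ)² u²)^{−z}` pulled back along `ℓ_w` (★ (D5-a3 core) `norm_iteratedFDeriv_comp_form_le`);
★ (D5-a3 core) `exists_norm_iteratedFDeriv_finset_prod_le`; §1 `‖φ₀‖·h_f^{−Re z}·∏_w(…)^{−Re z} = ‖φ₀‖·H^{Re z}`; `C_φ = ‖φ₀‖·C'`.
[cite: MoeglinWaldspurger1995, I.2.10–I.2.12, II.1.5] [cite: HormanderALPDO1, §7.1] [cite: Garrett2018, §2.2] -/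
theorem exists_archSmooth_flatSectionU_const_cm_two {δ : L} (hcδ : IsCMField.complexConj L δ = -δ) (hδ : δ ≠ 0) (z φ₀ : ℂ) (m : ℕ) :
    ∃ Cφ : ℝ, 0 ≤ Cφ ∧
    ∀ k ∈ ((standardMaximalCompactGL 2 L).comap (adelicVal ↥(maximalRealSubfield L) L (IsCMField.complexConj L) 2 ((StdForm.antidiagonal 2).over L)) : Subgroup (quasiSplit (↥(maximalRealSubfield L)) L (IsCMField.complexConj L) 2).Adelic), ∀ b : FiniteAdeleRing (𝓞 ↥(maximalRealSubfield L)) ↥(maximalRealSubfield L),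
      ContDiff ℝ m ((fun a : InfiniteAdeleRing ↥(maximalRealSubfield L) => flatSectionU (fun _ : (quasiSplit (↥(maximalRealSubfield L)) L (IsCMField.complexConj L) 2).Adelic => φ₀) z (((quasiSplit (↥(maximalRealSubfield L)) L (IsCMField.complexConj L) 2).toAdelic (weylLongU ((IsCMField.complexConj L : L ≃ₐ[↥(maximalRealSubfield L)] L) : L →+* L) (rfl : ((StdForm.antidiagonal 2).over L) = ((StdForm.antidiagonal 2).over L)))) *
          ((middleRootUnipotent hij hN (Multiplicative.ofAdd (traceZeroLine ↥(maximalRealSubfield L) L (IsCMField.complexConj L) hcδ hδ ((a, b) : AdeleRing (𝓞 ↥(maximalRealSubfield L)) ↥(maximalRealSubfield L)))) : ↥(adelicUnipotent ↥(maximalRealSubfield L) L (IsCMField.complexConj L) 2)) : (quasiSplit (↥(maximalRealSubfield L)) L (IsCMField.complexConj L) 2).Adelic) * k)) ∘ (InfiniteAdeleRing.ringEquiv_mixedSpace ↥(maximalRealSubfield L)).symm) ∧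
      ∀ j : ℕ, j ≤ m → ∀ s : mixedSpace ↥(maximalRealSubfield L),
        ‖iteratedFDeriv ℝ j ((fun a : InfiniteAdeleRing ↥(maximalRealSubfield L) => flatSectionU (fun _ : (quasiSplit (↥(maximalRealSubfield L)) L (IsCMField.complexConj L) 2).Adelic => φ₀) z (((quasiSplit (↥(maximalRealSubfield L)) L (IsCMField.complexConj L) 2).toAdelic (weylLongU ((IsCMField.complexConj L : L ≃ₐ[↥(maximalRealSubfield L)] L) : L →+* L) (rfl : ((StdForm.antidiagonal 2).over L) = ((StdForm.antidiagonal 2).over L)))) *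
          ((middleRootUnipotent hij hN (Multiplicative.ofAdd (traceZeroLine ↥(maximalRealSubfield L) L (IsCMField.complexConj L) hcδ hδ ((a, b) : AdeleRing (𝓞 ↥(maximalRealSubfield L)) ↥(maximalRealSubfield L)))) : ↥(adelicUnipotent ↥(maximalRealSubfield L) L (IsCMField.complexConj L) 2)) : (quasiSplit (↥(maximalRealSubfield L)) L (IsCMField.complexConj L) 2).Adelic) * k)) ∘ (InfiniteAdeleRing.ringEquiv_mixedSpace ↥(maximalRealSubfield L)).symm) s‖ ≤
          Cφ * (borelHeight (((quasiSplit (↥(maximalRealSubfield L)) L (IsCMField.complexConj L) 2).toAdelic (weylLongU ((IsCMField.complexConj L : L ≃ₐ[↥(maximalRealSubfield L)] L) : L →+* L) (rfl : ((StdForm.antidiagonal 2).over L) = ((StdForm.antidiagonal 2).over L)))) *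
          ((middleRootUnipotent hij hN (Multiplicative.ofAdd (traceZeroLine ↥(maximalRealSubfield L) L (IsCMField.complexConj L) hcδ hδ (((InfiniteAdeleRing.ringEquiv_mixedSpace ↥(maximalRealSubfield L)).symm s, b) : AdeleRing (𝓞 ↥(maximalRealSubfield L)) ↥(maximalRealSubfield L)))) : ↥(adelicUnipotent ↥(maximalRealSubfield L) L (IsCMField.complexConj L) 2)) : (quasiSplit (↥(maximalRealSubfield L)) L (IsCMField.complexConj L) 2).Adelic) * k) : ℝ) ^ z.re := by
  -- (0) letters: the per-place constants `c_w = (w δ)² > 0`, coordinate forms `ℓ_w`, one-variable symbols `F_w`, their pull-backs `g_w`, envelopes `e_w`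
  set c : InfinitePlace L → ℝ := fun w => (w δ) ^ 2 with hc_def
  have hc : ∀ w, 0 < c w := fun w => sq_apply_pos_of_ne_zero L hδ w
  set ℓ : InfinitePlace L → (mixedSpace ↥(maximalRealSubfield L) →L[ℝ] ℝ) := fun w =>
    (ContinuousLinearMap.proj (R := ℝ) (φ := fun _ : {v : InfinitePlace ↥(maximalRealSubfield L) // v.IsReal} => ℝ)
        ⟨w.comap (algebraMap ↥(maximalRealSubfield L) L), K2E1HeightBigCellLineFormulaU2.isReal_comap_maximalRealSubfield L w⟩).comp
      (ContinuousLinearMap.fst ℝ ({v : InfinitePlace ↥(maximalRealSubfield L) // v.IsReal} → ℝ) ({v : InfinitePlace ↥(maximalRealSubfield L) // v.IsComplex} → ℂ)) with hℓ_def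
  have hℓ : ∀ w, ‖ℓ w‖ ≤ 1 := fun w => norm_proj_comp_fst_le_one ↥(maximalRealSubfield L) _
  have hℓ_apply : ∀ w (s : mixedSpace ↥(maximalRealSubfield L)), ℓ w s = s.1 ⟨w.comap (algebraMap ↥(maximalRealSubfield L) L), K2E1HeightBigCellLineFormulaU2.isReal_comap_maximalRealSubfield L w⟩ :=
    fun w s => rfl
  set F : InfinitePlace L → ℝ → ℂ := fun w u => ((((1 + c w * u ^ 2 : ℝ)) : ℂ) ^ (-z)) with hF_def
  have hF : ∀ w, ContDiff ℝ (m : ℕ∞) (F w) := fun w => contDiff_onePlusSqPow (hc w).le z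
  set g : InfinitePlace L → mixedSpace ↥(maximalRealSubfield L) → ℂ := fun w => F w ∘ ℓ w with hg_def
  have hg : ∀ w ∈ (Finset.univ : Finset (InfinitePlace L)), ContDiff ℝ (m : ℕ∞) (g w) := fun w _ => (hF w).comp (ℓ w).contDiff
  set e : InfinitePlace L → mixedSpace ↥(maximalRealSubfield L) → ℝ := fun w s => (1 + c w * (ℓ w s) ^ 2) ^ (-z.re) with he_def
  have he : ∀ w ∈ (Finset.univ : Finset (InfinitePlace L)), ∀ s, 0 ≤ e w s := fun w _ s => Real.rpow_nonneg (onePlusSq_pos (hc w).le _).le _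
  -- (1) one constant for all places and all orders `j ≤ m` (★ (D5-a1) per place and order, summed)
  choose C hC0 hC using fun w : InfinitePlace L => fun j : ℕ => exists_norm_iteratedDeriv_le (hc w) z j
  set Cmax : ℝ := ∑ w : InfinitePlace L, ∑ j ∈ Finset.range (m + 1), C w j with hCmax_def
  have hCmax0 : 0 ≤ Cmax := Finset.sum_nonneg fun w _ => Finset.sum_nonneg fun j _ => hC0 w j
  have hCle : ∀ w, ∀ j ≤ m, C w j ≤ Cmax := by
    intro w j hj
    calc C w j ≤ ∑ j ∈ Finset.range (m + 1), C w j :=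
          Finset.single_le_sum (f := fun j => C w j) (fun i _ => hC0 w i) (Finset.mem_range.2 (Nat.lt_succ_of_le hj))
      _ ≤ Cmax := Finset.single_le_sum (f := fun w => ∑ j ∈ Finset.range (m + 1), C w j) (fun w _ => Finset.sum_nonneg fun j _ => hC0 w j) (Finset.mem_univ w)
  have hb : ∀ w ∈ (Finset.univ : Finset (InfinitePlace L)), ∀ j ≤ m, ∀ s, ‖iteratedFDeriv ℝ j (g w) s‖ ≤ Cmax * e w s := by
    intro w _ j hj s
    have hjm : (j : WithTop ℕ∞) ≤ (m : ℕ∞) := by exact_mod_cast hj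
    calc ‖iteratedFDeriv ℝ j (g w) s‖ ≤ ‖iteratedDeriv j (F w) (ℓ w s)‖ := norm_iteratedFDeriv_comp_form_le (hF w) (ℓ w) (hℓ w) s hjm
      _ ≤ C w j * (1 + c w * (ℓ w s) ^ 2) ^ (-z.re) := hC w j (ℓ w s)
      _ ≤ Cmax * e w s := mul_le_mul_of_nonneg_right (hCle w j hj) (he w (Finset.mem_univ w) s)
  -- (2) the tensor Leibniz rule ★ (D5-a3 core)
  obtain ⟨hprod, C', hC', hbound⟩ := exists_norm_iteratedFDeriv_finset_prod_le (Finset.univ : Finset (InfinitePlace L)) hg (le_refl _) hCmax0 he hb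
  refine ⟨‖φ₀‖ * C', mul_nonneg (norm_nonneg _) hC', fun k hk b => ?_⟩
  -- (3) the finite factor `h_f(b) ≥ 1`
  have hhf0 : 0 < ((∏ᶠ v : HeightOneSpectrum (𝓞 L), max 1 ‖((traceZeroLine ↥(maximalRealSubfield L) L (IsCMField.complexConj L) hcδ hδ ((0, b) : AdeleRing (𝓞 ↥(maximalRealSubfield L)) ↥(maximalRealSubfield L)) : traceZeroAdele ↥(maximalRealSubfield L) L (IsCMField.complexConj L)) : AdeleRing (𝓞 L) L).2 v‖₊ : ℝ≥0) : ℝ) :=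
    zero_lt_one.trans_le (one_le_coe_finprod_line_cm_two L hcδ hδ b)
  -- (4) the line function IS `A • ∏_w g_w` (§2)
  have hfun : ((fun a : InfiniteAdeleRing ↥(maximalRealSubfield L) => flatSectionU (fun _ : (quasiSplit (↥(maximalRealSubfield L)) L (IsCMField.complexConj L) 2).Adelic => φ₀) z (((quasiSplit (↥(maximalRealSubfield L)) L (IsCMField.complexConj L) 2).toAdelic (weylLongU ((IsCMField.complexConj L : L ≃ₐ[↥(maximalRealSubfield L)] L) : L →+* L) (rfl : ((StdForm.antidiagonal 2).over L) = ((StdForm.antidiagonal 2).over L)))) *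
          ((middleRootUnipotent hij hN (Multiplicative.ofAdd (traceZeroLine ↥(maximalRealSubfield L) L (IsCMField.complexConj L) hcδ hδ ((a, b) : AdeleRing (𝓞 ↥(maximalRealSubfield L)) ↥(maximalRealSubfield L)))) : ↥(adelicUnipotent ↥(maximalRealSubfield L) L (IsCMField.complexConj L) 2)) : (quasiSplit (↥(maximalRealSubfield L)) L (IsCMField.complexConj L) 2).Adelic) * k)) ∘ (InfiniteAdeleRing.ringEquiv_mixedSpace ↥(maximalRealSubfield L)).symm) =
      (φ₀ * (((((∏ᶠ v : HeightOneSpectrum (𝓞 L), max 1 ‖((traceZeroLine ↥(maximalRealSubfield L) L (IsCMField.complexConj L) hcδ hδ ((0, b) : AdeleRing (𝓞 ↥(maximalRealSubfield L)) ↥(maximalRealSubfield L)) : traceZeroAdele ↥(maximalRealSubfield L) L (IsCMField.complexConj L)) : AdeleRing (𝓞 L) L).2 v‖₊ : ℝ≥0) : ℝ)⁻¹ : ℝ) : ℂ) ^ z)) • fun s => ∏ w, g w s := by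
    funext s
    rw [flatSectionU_const_line_apply_cm_two L hij hN hcδ hδ z φ₀ hk b s, Pi.smul_apply, smul_eq_mul, mul_assoc]
    rfl
  -- (5) smoothness
  have hcd : ContDiff ℝ m ((φ₀ * (((((∏ᶠ v : HeightOneSpectrum (𝓞 L), max 1 ‖((traceZeroLine ↥(maximalRealSubfield L) L (IsCMField.complexConj L) hcδ hδ ((0, b) : AdeleRing (𝓞 ↥(maximalRealSubfield L)) ↥(maximalRealSubfield L)) : traceZeroAdele ↥(maximalRealSubfield L) L (IsCMField.complexConj L)) : AdeleRing (𝓞 L) L).2 v‖₊ : ℝ≥0) : ℝ)⁻¹ : ℝ) : ℂ) ^ z)) • fun s => ∏ w, g w s) := hprod.const_smul (φ₀ * (((((∏ᶠ v : HeightOneSpectrum (𝓞 L), max 1 ‖((traceZeroLine ↥(maximalRealSubfield L) L (IsCMField.complexConj L) hcδ hδ ((0, b) : AdeleRing (𝓞 ↥(maximalRealSubfield L)) ↥(maximalRealSubfield L)) : traceZeroAdele ↥(maximalRealSubfield L) L (IsCMField.complexConj L)) : AdeleRing (𝓞 L) L).2 v‖₊ : ℝ≥0) : ℝ)⁻¹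 : ℝ) : ℂ) ^ z))
  refine ⟨by rw [hfun]; exact hcd, fun j hj s => ?_⟩
  rw [hfun, iteratedFDeriv_const_smul_apply ((hprod.of_le (by exact_mod_cast hj)).contDiffAt), _root_.norm_smul]
  -- (6) the estimate: `‖A‖·‖Dʲ∏‖ ≤ ‖A‖·C'·∏ e_w = ‖φ₀‖·C'·H^{Re z}`
  have hprodb := hbound j hj s
  have hA : ‖(φ₀ * (((((∏ᶠ v : HeightOneSpectrum (𝓞 L), max 1 ‖((traceZeroLine ↥(maximalRealSubfield L) L (IsCMField.complexConj L) hcδ hδ ((0, b) : AdeleRing (𝓞 ↥(maximalRealSubfield L)) ↥(maximalRealSubfield L)) : traceZeroAdele ↥(maximalRealSubfield L) L (IsCMField.complexConj L)) : AdeleRing (𝓞 L) L).2 v‖₊ : ℝ≥0) : ℝ)⁻¹ : ℝ) : ℂ) ^ z))‖ = ‖φ₀‖ * ‖(((((∏ᶠ v : HeightOneSpectrum (𝓞 L), max 1 ‖((traceZeroLine ↥(maximalRealSubfield L) L (IsCMField.complexConj L) hcδ hδ ((0, b) : AdeleRing (𝓞 ↥(maximalRealSubfield L)) ↥(maximalRealSubfield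 L)) : traceZeroAdele ↥(maximalRealSubfield L) L (IsCMField.complexConj L)) : AdeleRing (𝓞 L) L).2 v‖₊ : ℝ≥0) : ℝ)⁻¹ : ℝ)) : ℂ) ^ z‖ := norm_mul _ _
  have hH : ‖(((((∏ᶠ v : HeightOneSpectrum (𝓞 L), max 1 ‖((traceZeroLine ↥(maximalRealSubfield L) L (IsCMField.complexConj L) hcδ hδ ((0, b) : AdeleRing (𝓞 ↥(maximalRealSubfield L)) ↥(maximalRealSubfield L)) : traceZeroAdele ↥(maximalRealSubfield L) L (IsCMField.complexConj L)) : AdeleRing (𝓞 L) L).2 v‖₊ : ℝ≥0) : ℝ)⁻¹ : ℝ)) : ℂ) ^ z‖ * ∏ w, e w s =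
      (borelHeight (((quasiSplit (↥(maximalRealSubfield L)) L (IsCMField.complexConj L) 2).toAdelic (weylLongU ((IsCMField.complexConj L : L ≃ₐ[↥(maximalRealSubfield L)] L) : L →+* L) (rfl : ((StdForm.antidiagonal 2).over L) = ((StdForm.antidiagonal 2).over L)))) *
          ((middleRootUnipotent hij hN (Multiplicative.ofAdd (traceZeroLine ↥(maximalRealSubfield L) L (IsCMField.complexConj L) hcδ hδ (((InfiniteAdeleRing.ringEquiv_mixedSpace ↥(maximalRealSubfield L)).symm s, b) : AdeleRing (𝓞 ↥(maximalRealSubfield L)) ↥(maximalRealSubfield L)))) : ↥(adelicUnipotent ↥(maximalRealSubfield L) L (IsCMField.complexConj L) 2)) : (quasiSplit (↥(maximalRealSubfield L)) L (IsCMField.complexConj L) 2).Adelic) * k) : ℝ) ^ z.re := by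
    rw [coe_borelHeight_weylLongU_line_mul_eq_cm_two L hij hN hcδ hδ hk b s,
      ← norm_ofReal_inv_cpow_mul_prod_rpow_neg Finset.univ (fun w _ => (onePlusSq_pos (hc w).le _).le) hhf0 z]
    rfl
  calc ‖(φ₀ * (((((∏ᶠ v : HeightOneSpectrum (𝓞 L), max 1 ‖((traceZeroLine ↥(maximalRealSubfield L) L (IsCMField.complexConj L) hcδ hδ ((0, b) : AdeleRing (𝓞 ↥(maximalRealSubfield L)) ↥(maximalRealSubfield L)) : traceZeroAdele ↥(maximalRealSubfield L) L (IsCMField.complexConj L)) : AdeleRing (𝓞 L) L).2 v‖₊ : ℝ≥0) : ℝ)⁻¹ : ℝ) : ℂ) ^ z))‖ * ‖iteratedFDeriv ℝ j (fun s => ∏ w, g w s) s‖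
        ≤ ‖(φ₀ * (((((∏ᶠ v : HeightOneSpectrum (𝓞 L), max 1 ‖((traceZeroLine ↥(maximalRealSubfield L) L (IsCMField.complexConj L) hcδ hδ ((0, b) : AdeleRing (𝓞 ↥(maximalRealSubfield L)) ↥(maximalRealSubfield L)) : traceZeroAdele ↥(maximalRealSubfield L) L (IsCMField.complexConj L)) : AdeleRing (𝓞 L) L).2 v‖₊ : ℝ≥0) : ℝ)⁻¹ : ℝ) : ℂ) ^ z))‖ * (C' * ∏ w, e w s) := mul_le_mul_of_nonneg_left hprodb (norm_nonneg _)
    _ = ‖φ₀‖ * C' * (‖(((((∏ᶠ v : HeightOneSpectrum (𝓞 L), max 1 ‖((traceZeroLine ↥(maximalRealSubfield L) L (IsCMField.complexConj L) hcδ hδ ((0, b) : AdeleRing (𝓞 ↥(maximalRealSubfield L)) ↥(maximalRealSubfield L)) : traceZeroAdele ↥(maximalRealSubfield L) L (IsCMField.complexConj L)) : AdeleRing (𝓞 L) L).2 v‖₊ : ℝ≥0) : ℝ)⁻¹ : ℝ)) : ℂ) ^ z‖ * ∏ w, e w s) := by rw [hA]; ring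
    _ = _ := by rw [hH]

end ArchSmooth

/-! ## §4 The consumers, spherical case: every `φ`-hypothesis of ★ p857911 discharged -/

section Plug

open MeasureTheory Module Literature.NumberTheory.GaloisRepresentations
open Summit.HodgeConjecture.HodgeConjecture.Cruxes.H413.K2E1EisensteinMinusConstantTermBoundedLevelCMTwo

variable (L : Type) [Field L] [NumberField L] [IsCMField L]
  (hij : (((0 : Fin 2) : ℕ)) + 1 = ((1 : Fin 2) : ℕ)) (hN : 2 = 2 * ((0 : Fin 2) : ℕ) + 2)
  [MeasurableSpace (quasiSplit (↥(maximalRealSubfield L)) L (IsCMField.complexConj L) 2).Adelic] [BorelSpace (quasiSplit (↥(maximalRealSubfield L)) L (IsCMField.complexConj L) 2).Adelic]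
  [MeasurableSpace (AdeleRing (𝓞 L) L)] [BorelSpace (AdeleRing (𝓞 L) L)]
  [MeasurableSpace (AdeleRing (𝓞 ↥(maximalRealSubfield L)) ↥(maximalRealSubfield L))] [BorelSpace (AdeleRing (𝓞 ↥(maximalRealSubfield L)) ↥(maximalRealSubfield L))]
  [MeasurableSpace (InfiniteAdeleRing ↥(maximalRealSubfield L))] [BorelSpace (InfiniteAdeleRing ↥(maximalRealSubfield L))]
  [MeasurableSpace (FiniteAdeleRing (𝓞 ↥(maximalRealSubfield L)) ↥(maximalRealSubfield L))] [BorelSpace (FiniteAdeleRing (𝓞 ↥(maximalRealSubfield L)) ↥(maximalRealSubfield L))]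

include hij hN in
/-- **`E(f_z) − E(f_z)_B` IS BOUNDED IN THE CUSP OF `U(1,1)` OVER A CM FIELD FOR THE SPHERICAL FLAT SECTION `f_z = φ₀·H^z`** (`1 < Re z`, `m > [L⁺:ℚ]`, `T ≥ 1`):
★ p857911 `exists_bound_sub_borelConstantTerm_level_cm_two_of_archSmooth` at `φ ≡ φ₀`, `U₀ = GL₂(𝒪̂_L)`, with `hφarch` supplied by §3 and every other `φ`-hypothesis trivial; the one
remaining input is the modularity `hf` of `f_z` under `B(𝔸)` (`hij`, `hN` are the two `rfl` side conditions of the line chart). [cite: MoeglinWaldspurger1995, I.2.10–I.2.12, II.1.7]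
[cite: Garrett2018, §2.9] -/
theorem exists_bound_sub_borelConstantTerm_level_cm_two_const {δ : L} (hcδ : IsCMField.complexConj L δ = -δ) (hδ : δ ≠ 0)
    (ν : Measure ↥(adelicUnipotent ↥(maximalRealSubfield L) L (IsCMField.complexConj L) 2)) [ν.IsHaarMeasure]
    {𝓕 : Set ↥(adelicUnipotent ↥(maximalRealSubfield L) L (IsCMField.complexConj L) 2)} (h𝓕 : IsFundamentalDomain ↥(rationalUnipotent ↥(maximalRealSubfield L) L (IsCMField.complexConj L) 2) 𝓕 ν)
    (h𝓕c : IsCompact (closure 𝓕))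
    (μ : Measure (AdeleRing (𝓞 ↥(maximalRealSubfield L)) ↥(maximalRealSubfield L))) [μ.IsAddHaarMeasure]
    (μ₁ : Measure (InfiniteAdeleRing ↥(maximalRealSubfield L))) [μ₁.IsAddHaarMeasure] (μ₂ : Measure (FiniteAdeleRing (𝓞 ↥(maximalRealSubfield L)) ↥(maximalRealSubfield L))) [μ₂.IsAddHaarMeasure]
    (χ : HeckeCharacter L) (hχ : χ.IsUnitary) {z : ℂ} (hz : 1 < z.re) (φ₀ : ℂ)
    (hf : ∀ (b g : (quasiSplit (↥(maximalRealSubfield L)) L (IsCMField.complexConj L) 2).Adelic) (u : (AdeleRing (𝓞 L) L)ˣ),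
      ((b.1 : GL (Fin 2) (AdeleRing (𝓞 L) L)) : Matrix (Fin 2) (Fin 2) (AdeleRing (𝓞 L) L)) 1 0 = 0 →
      (u : (AdeleRing (𝓞 L) L)) = ((b.1 : GL (Fin 2) (AdeleRing (𝓞 L) L)) : Matrix (Fin 2) (Fin 2) (AdeleRing (𝓞 L) L)) 0 0 →
        flatSectionU (fun _ : (quasiSplit (↥(maximalRealSubfield L)) L (IsCMField.complexConj L) 2).Adelic => φ₀) z (b * g) =
          ((χ u : ℂˣ) : ℂ) * ((ideleNorm u : ℝ) : ℂ) ^ z * flatSectionU (fun _ : (quasiSplit (↥(maximalRealSubfield L)) L (IsCMField.complexConj L) 2).Adelic => φ₀) z g)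
    {T : ℝ≥0} (hT : 1 ≤ T) {m : ℕ} (hm : (finrank ℚ ↥(maximalRealSubfield L) : ℝ) < m) :
    ∃ M₁ : ℝ, ∀ g : (quasiSplit (↥(maximalRealSubfield L)) L (IsCMField.complexConj L) 2).Adelic, T < borelHeight g →
      ‖eisensteinSeriesU (flatSectionU (fun _ : (quasiSplit (↥(maximalRealSubfield L)) L (IsCMField.complexConj L) 2).Adelic => φ₀) z) g -
        borelConstantTerm ν 𝓕 (eisensteinSeriesU (flatSectionU (fun _ : (quasiSplit (↥(maximalRealSubfield L)) L (IsCMField.complexConj L) 2).Adelic => φ₀) z)) g‖ ≤ M₁ := by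
  obtain ⟨Cφ, hCφ, hφarch⟩ := exists_archSmooth_flatSectionU_const_cm_two L hij hN hcδ hδ z φ₀ m
  exact exists_bound_sub_borelConstantTerm_level_cm_two_of_archSmooth L hij hN hcδ hδ ν h𝓕 h𝓕c μ μ₁ μ₂ χ hχ hz continuous_const (fun _ => le_refl ‖φ₀‖)
    (fun _ _ _ => rfl) hf (isOpen_glFiniteIntegralLevel 2 L) le_rfl (fun _ _ _ => rfl) hT hm hCφ hφarch

include hij hN in
/-- **`Λ^T E(f_z)` IS BOUNDED ON `U(J₂)(𝔸)` OVER A CM FIELD FOR THE SPHERICAL FLAT SECTION** — ★ p857911 `exists_norm_truncation_flatSectionU_le_level_cm_two_of_archSmooth` at `φ ≡ φ₀`,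
all `φ`-hypotheses discharged (§3, `U₀ = GL₂(𝒪̂_L)`). [cite: MoeglinWaldspurger1995, I.2.13, IV.2] [cite: Garrett2018, §2.10–§2.11] -/
theorem exists_norm_truncation_flatSectionU_le_level_cm_two_const {δ : L} (hcδ : IsCMField.complexConj L δ = -δ) (hδ : δ ≠ 0)
    (ν : Measure ↥(adelicUnipotent ↥(maximalRealSubfield L) L (IsCMField.complexConj L) 2)) [ν.IsHaarMeasure]
    {𝓕 : Set ↥(adelicUnipotent ↥(maximalRealSubfield L) L (IsCMField.complexConj L) 2)} (h𝓕 : IsFundamentalDomain ↥(rationalUnipotent ↥(maximalRealSubfield L) L (IsCMField.complexConj L) 2) 𝓕 ν)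
    (h𝓕c : IsCompact (closure 𝓕))
    (μ : Measure (AdeleRing (𝓞 ↥(maximalRealSubfield L)) ↥(maximalRealSubfield L))) [μ.IsAddHaarMeasure]
    (μ₁ : Measure (InfiniteAdeleRing ↥(maximalRealSubfield L))) [μ₁.IsAddHaarMeasure] (μ₂ : Measure (FiniteAdeleRing (𝓞 ↥(maximalRealSubfield L)) ↥(maximalRealSubfield L))) [μ₂.IsAddHaarMeasure]
    (χ : HeckeCharacter L) (hχ : χ.IsUnitary) {z : ℂ} (hz : 1 < z.re) (φ₀ : ℂ)
    (hf : ∀ (b g : (quasiSplit (↥(maximalRealSubfield L)) L (IsCMField.complexConj L) 2).Adelic) (u : (AdeleRing (𝓞 L) L)ˣ),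
      ((b.1 : GL (Fin 2) (AdeleRing (𝓞 L) L)) : Matrix (Fin 2) (Fin 2) (AdeleRing (𝓞 L) L)) 1 0 = 0 →
      (u : (AdeleRing (𝓞 L) L)) = ((b.1 : GL (Fin 2) (AdeleRing (𝓞 L) L)) : Matrix (Fin 2) (Fin 2) (AdeleRing (𝓞 L) L)) 0 0 →
        flatSectionU (fun _ : (quasiSplit (↥(maximalRealSubfield L)) L (IsCMField.complexConj L) 2).Adelic => φ₀) z (b * g) =
          ((χ u : ℂˣ) : ℂ) * ((ideleNorm u : ℝ) : ℂ) ^ z * flatSectionU (fun _ : (quasiSplit (↥(maximalRealSubfield L)) L (IsCMField.complexConj L) 2).Adelic => φ₀) z g)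
    {T : ℝ≥0} (hT : 1 ≤ T) {m : ℕ} (hm : (finrank ℚ ↥(maximalRealSubfield L) : ℝ) < m) :
    ∃ M : ℝ, ∀ g : (quasiSplit (↥(maximalRealSubfield L)) L (IsCMField.complexConj L) 2).Adelic,
      ‖truncation ν 𝓕 T (eisensteinSeriesU (flatSectionU (fun _ : (quasiSplit (↥(maximalRealSubfield L)) L (IsCMField.complexConj L) 2).Adelic => φ₀) z)) g‖ ≤ M := by
  obtain ⟨Cφ, hCφ, hφarch⟩ := exists_archSmooth_flatSectionU_const_cm_two L hij hN hcδ hδ z φ₀ m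
  exact exists_norm_truncation_flatSectionU_le_level_cm_two_of_archSmooth L hij hN hcδ hδ ν h𝓕 h𝓕c μ μ₁ μ₂ χ hχ hz continuous_const (fun _ => le_refl ‖φ₀‖)
    (fun _ _ _ => rfl) hf (isOpen_glFiniteIntegralLevel 2 L) le_rfl (fun _ _ _ => rfl) hT hm hCφ hφarch

end Plug

end Summit.HodgeConjecture.HodgeConjecture.Cruxes.H413.K2E1HeightLineArchSmoothU2

end
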